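import Literature.Analysis.FunctionSpaces.SteinLineOperator
import HarnessLib

/-!
# The derivatives of Stein's extension operator below the graph: symbolic calculus

E. M. Stein, *Singular Integrals and Differentiability Properties of Functions* (1970), Ch. VI,
§3.2.3, formula (26): the derivatives of `𝔈(f)(x, y) = ∫₁^∞ f(x, y + λδ*(x,y)) ψ(λ) dλ` below
the graph are sums of terms `c(x, y) ∫ (∂^β f)(x, y + λδ*) λ^r ψ(λ) dλ`, the coefficients `c`
being products of derivatives of the scaled regularized distance `δ*` (each factor carrying
one power of `λ`), and a derivative of order `m` produces terms in which `f` is differentiated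
`|β| ≤ m` times, the defect `m - |β|` being the total excess order of the factors of `c`.
This file makes that bookkeeping formal, for the line operators `lineOp` of
`SteinLineOperator` on a normed space with a family of directions `b : ι → E'` and the
vertical direction `u`:

* `Literature.CExpr ι`: symbolic coefficients — `one`, an atom `∂_β δ` (`β` a nonempty word in `ι`),
  or a product; with `atoms` (number of factors = power of `λ`), `excess`
  (`Σ (|β| - 1)`), evaluation `eval b δ`, the formal derivative `D i` (product rule) and the
  bound `bound B` (product of bounds of the atoms);
* `Literature.STerm ι`: a coefficient together with a word over `Option ι` (`none` = the direction
  `u`) recording the derivative falling on the function; `eval` is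
  `c(z) • lineOp u (∂_w g) (t ↦ t^{atoms c} ψ(t)) δ z`; the formal derivative `D i` of a term
  (three kinds of children: derivative on the coefficient, on the function, on the scale) and
  the lists `terms w` generated from the root by the letters of `w`;
* `Literature.steinR … w = lineOp u (∂_w g) ψ δ + Σ_{τ ∈ terms w} eval τ`, and the **derivative
  formula** `∂_{bᵢ} (steinR w) = steinR (i :: w)` on `{δ smooth}` (`Literature.Analysis.FunctionSpaces.fderiv_steinR_apply`),
  i.e. Stein's (26) at all orders;
* the **invariants** of the generated terms (`Literature.Analysis.FunctionSpaces.STerm.terms_inv`): well-formedness,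
  `|τ.w| + excess τ.c = |w|`, `1 ≤ atoms τ.c ≤ |τ.w|` — which say exactly that the kernel
  `t^r ψ` of a term of excess `e` has its moments `r, …, r + e` among the moments `1, …, |w|`
  of `ψ` that vanish (Stein, after (26): the substituted integrals "vanish identically by the
  orthogonality condition on `ψ`").

* finally, for use in the a priori estimate (`SteinExtensionAPriori`): Stein's operator
  pointwise, `Literature.steinOp u d ψ δ f = f` on `{d ≤ 0}` and `= lineOp u f ψ δ` on `{d > 0}`
  (Stein's (24), for a depth function `d` whose negative set is the domain), with its
  linearity on continuous functions, and the recursive Sobolev sums `Literature.Analysis.FunctionSpaces.swN` / `Literature.Analysis.FunctionSpaces.pureN` of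
  `L^p` norms of classical directional derivatives of a smooth function (the shape of
  `eSobolevDomainNorm` with classical in place of weak derivatives).

## References

* E. M. Stein, *Singular Integrals and Differentiability Properties of Functions*, Princeton
  Math. Series 30 (1970), Ch. VI, §3.2 (24), §3.2.3, (25)–(26).
-/

noncomputable section

open MeasureTheory TopologicalSpace Filter Set Metric Function
open scoped Topology ContDiff NNReal ENNReal

namespace Literature.Analysis.FunctionSpaces

/-! ### Symbolic coefficients -/

/-- Symbolic coefficients of the terms in the derivatives of Stein's operator: `1`, an
iterated directional derivative `∂_β δ` of the scale function along a nonempty word `β` of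
basis directions, or a product of two coefficients (Stein, Ch. VI, §3.2.3, (26): the factors
`∂^γ δ*` in front of the integrals). [folklore] -/
inductive CExpr (ι : Type*) : Type _
  /-- The constant coefficient `1`. -/
  | one : CExpr ι
  /-- The atom `∂_β δ`. -/
  | atom : List ι → CExpr ι
  /-- A product of coefficients. -/
  | mul : CExpr ι → CExpr ι → CExpr ι

namespace CExpr

variable {ι : Type*}

/-- The number of factors `∂_β δ` (each factor carries one power of `λ` in the kernel). [folklore] -/
def atoms : CExpr ι → ℕ
  | one => 0
  | atom _ => 1
  | mul a c => a.atoms + c.atoms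

/-- The total excess order `Σ (|β| - 1)` of the factors (the power of the depth by which the
coefficient may blow up at the boundary). [folklore] -/
def excess : CExpr ι → ℕ
  | one => 0
  | atom β => β.length - 1
  | mul a c => a.excess + c.excess

/-- Well-formedness: all atoms are derivatives of positive order. [folklore] -/
def Wf : CExpr ι → Prop
  | one => True
  | atom β => β ≠ []
  | mul a c => a.Wf ∧ c.Wf

/-- The formal derivative in the direction `bᵢ` (product rule), as a list of coefficients whose
sum is the derivative. [folklore] -/
def D (i : ι) : CExpr ι → List (CExpr ι)
  | one => []
  | atom β => [atom (i :: β)]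
  | mul a c => (a.D i).map (fun a' => mul a' c) ++ (c.D i).map (fun c' => mul a c')

/-- The bound of a coefficient from bounds `B β` for the atoms (a product). [folklore] -/
def bound (B : List ι → ℝ) : CExpr ι → ℝ
  | one => 1
  | atom β => B β
  | mul a c => a.bound B * c.bound B

/-- Children of the formal derivative keep the number of atoms. [folklore] -/
theorem atoms_of_mem_D (i : ι) : ∀ (c : CExpr ι), ∀ c' ∈ c.D i, c'.atoms = c.atoms
  | one, c', h => by simp [D] at h
  | atom _, c', h => by
    simp only [D, List.mem_singleton] at h
    subst h; rfl
  | mul a c, c', h => by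
    simp only [D, List.mem_append, List.mem_map] at h
    rcases h with ⟨a', ha', rfl⟩ | ⟨c'', hc'', rfl⟩
    · simp [atoms, atoms_of_mem_D i a a' ha']
    · simp [atoms, atoms_of_mem_D i c c'' hc'']

/-- Children of the formal derivative of a well-formed coefficient have excess one more.
[folklore] -/
theorem excess_of_mem_D (i : ι) : ∀ (c : CExpr ι), c.Wf → ∀ c' ∈ c.D i, c'.excess = c.excess + 1
  | one, _, c', h => by simp [D] at h
  | atom β, hw, c', h => by
    simp only [D, List.mem_singleton] at h
    subst h
    simp only [excess, List.length_cons]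
    have : β.length ≠ 0 := fun h' => hw (List.length_eq_zero_iff.1 h')
    omega
  | mul a c, hw, c', h => by
    simp only [D, List.mem_append, List.mem_map] at h
    rcases h with ⟨a', ha', rfl⟩ | ⟨c'', hc'', rfl⟩
    · simp only [excess, excess_of_mem_D i a hw.1 a' ha']; ring
    · simp only [excess, excess_of_mem_D i c hw.2 c'' hc'']; ring

/-- Children of the formal derivative of a well-formed coefficient are well-formed. [folklore] -/
theorem wf_of_mem_D (i : ι) : ∀ (c : CExpr ι), c.Wf → ∀ c' ∈ c.D i, c'.Wf
  | one, _, c', h => by simp [D] at h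
  | atom β, _, c', h => by
    simp only [D, List.mem_singleton] at h
    subst h; exact List.cons_ne_nil _ _
  | mul a c, hw, c', h => by
    simp only [D, List.mem_append, List.mem_map] at h
    rcases h with ⟨a', ha', rfl⟩ | ⟨c'', hc'', rfl⟩
    · exact ⟨wf_of_mem_D i a hw.1 a' ha', hw.2⟩
    · exact ⟨hw.1, wf_of_mem_D i c hw.2 c'' hc''⟩

/-- A coefficient without atoms has no excess. [folklore] -/
theorem excess_eq_zero_of_atoms_eq_zero : ∀ (c : CExpr ι), c.atoms = 0 → c.excess = 0
  | one, _ => rfl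
  | atom _, h => by simp [atoms] at h
  | mul a c, h => by
    simp only [atoms, Nat.add_eq_zero_iff] at h
    simp [excess, excess_eq_zero_of_atoms_eq_zero a h.1, excess_eq_zero_of_atoms_eq_zero c h.2]

/-- Nonnegativity of the bound. [folklore] -/
theorem bound_nonneg {B : List ι → ℝ} (hB : ∀ β, 0 ≤ B β) : ∀ (c : CExpr ι), 0 ≤ c.bound B
  | one => zero_le_one
  | atom β => hB β
  | mul a c => mul_nonneg (bound_nonneg hB a) (bound_nonneg hB c)

variable {E' : Type*} [NormedAddCommGroup E'] [NormedSpace ℝ E']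

/-- Evaluation of a symbolic coefficient at the scale function `δ` and the directions `b`.
[folklore] -/
def eval (b : ι → E') (δ : E' → ℝ) : CExpr ι → E' → ℝ
  | one => fun _ => 1
  | atom β => iterDirDeriv (β.map b) δ
  | mul a c => fun z => a.eval b δ z * c.eval b δ z

/-- Coefficients are smooth where the scale function is. [folklore] -/
theorem contDiffOn_eval (b : ι → E') {δ : E' → ℝ} {U : Set E'} (hU : IsOpen U)
    (hδ : ContDiffOn ℝ ∞ δ U) : ∀ (c : CExpr ι), ContDiffOn ℝ ∞ (c.eval b δ) U
  | one => contDiffOn_const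
  | atom _ => contDiffOn_iterDirDeriv hU hδ _
  | mul a c => (contDiffOn_eval b hU hδ a).mul (contDiffOn_eval b hU hδ c)

/-- **Product rule for the coefficients**: on `U`, `∂_{bᵢ} (eval c) = Σ_{c' ∈ D i c} eval c'`.
[folklore] -/
theorem fderiv_eval_apply (b : ι → E') {δ : E' → ℝ} {U : Set E'} (hU : IsOpen U)
    (hδ : ContDiffOn ℝ ∞ δ U) (i : ι) {z : E'} (hz : z ∈ U) :
    ∀ (c : CExpr ι), fderiv ℝ (c.eval b δ) z (b i) = ((c.D i).map fun c' => c'.eval b δ z).sum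
  | one => by simp [eval, D]
  | atom β => by simp [eval, D, iterDirDeriv_cons]
  | mul a c => by
    have ha : DifferentiableAt ℝ (a.eval b δ) z :=
      ((contDiffOn_eval b hU hδ a).differentiableOn (by simp)).differentiableAt (hU.mem_nhds hz)
    have hc : DifferentiableAt ℝ (c.eval b δ) z :=
      ((contDiffOn_eval b hU hδ c).differentiableOn (by simp)).differentiableAt (hU.mem_nhds hz)
    change fderiv ℝ (fun z => a.eval b δ z * c.eval b δ z) z (b i) = _
    rw [fderiv_fun_mul ha hc]
    simp only [add_apply, FunLike.coe_smul, Pi.smul_apply,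
      smul_eq_mul, fderiv_eval_apply b hU hδ i hz a, fderiv_eval_apply b hU hδ i hz c, D,
      List.map_append, List.map_map, List.sum_append]
    rw [add_comm]
    congr 1
    · rw [mul_comm, ← List.sum_map_mul_right]
      rfl
    · rw [← List.sum_map_mul_left]
      rfl

/-- **Weighted bounds for the coefficients**: if `|∂_β δ| d^{|β|-1} ≤ B β` on `U` for all
nonempty `β`, then `|eval c| d^{excess c} ≤ bound B c` on `U` for well-formed `c` (Stein,
Ch. VI, §2.1, Theorem 2 (b), used in the proof of Theorem 5'). [folklore] -/
theorem abs_eval_mul_pow_le (b : ι → E') {δ d : E' → ℝ} {U : Set E'} {B : List ι → ℝ}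
    (hB : ∀ β : List ι, β ≠ [] → ∀ z ∈ U,
      |iterDirDeriv (β.map b) δ z| * d z ^ (β.length - 1) ≤ B β)
    (hB0 : ∀ β, 0 ≤ B β) (hd : ∀ z ∈ U, 0 < d z) {z : E'} (hz : z ∈ U) :
    ∀ (c : CExpr ι), c.Wf → |c.eval b δ z| * d z ^ c.excess ≤ c.bound B
  | one, _ => by simp [eval, excess, bound]
  | atom β, hw => hB β hw z hz
  | mul a c, hw => by
    have h1 := abs_eval_mul_pow_le b hB hB0 hd hz a hw.1
    have h2 := abs_eval_mul_pow_le b hB hB0 hd hz c hw.2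
    calc |(mul a c).eval b δ z| * d z ^ (mul a c).excess
        = (|a.eval b δ z| * d z ^ a.excess) * (|c.eval b δ z| * d z ^ c.excess) := by
          simp only [eval, excess, abs_mul, pow_add]; ring
      _ ≤ a.bound B * c.bound B :=
          mul_le_mul h1 h2 (mul_nonneg (abs_nonneg _) (pow_nonneg (hd z hz).le _))
            (bound_nonneg hB0 a)

end CExpr

/-! ### Symbolic terms -/

/-- A symbolic term: a coefficient and a word over `Option ι` recording the derivative falling
on the function (`none` = the vertical direction `u`, `some i` = the direction `bᵢ`); it stands
for `c(z) • ∫ t^{atoms c} ψ(t) • (∂_w g)(z + t δ(z) u) dt` (Stein, (26)). [folklore] -/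
structure STerm (ι : Type*) where
  /-- The symbolic coefficient. -/
  c : CExpr ι
  /-- The word of directions of the derivative falling on the function. -/
  w : List (Option ι)

namespace STerm

variable {ι : Type*}

/-- The formal derivative of a term in the direction `bᵢ`: the derivative falls on the
coefficient, on the function, or on the scale inside the function (Stein, the three kinds of
terms in (26)). [folklore] -/
def D (i : ι) (τ : STerm ι) : List (STerm ι) :=
  (τ.c.D i).map (fun c' => ⟨c', τ.w⟩) ++
    [⟨τ.c, some i :: τ.w⟩, ⟨CExpr.mul (CExpr.atom [i]) τ.c, none :: τ.w⟩]

/-- The non-principal terms generated by differentiating along the letters of `w` (head =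
outermost derivative): the principal term `∫ ψ • (∂_w g)(z + t δ u) dt` is kept apart, and each
new letter `i` contributes the term `(∂ᵢ δ) ∫ t ψ • (∂ᵤ ∂_w g)` from the principal one and the
formal derivatives of the previous terms. [folklore] -/
def terms : List ι → List (STerm ι)
  | [] => []
  | i :: w => ⟨CExpr.mul (CExpr.atom [i]) CExpr.one, none :: w.map some⟩ :: (terms w).flatMap (D i)

/-- **Invariants of the generated terms**: well-formed coefficient, `|τ.w| + excess = |w|`, and
`1 ≤ atoms ≤ |τ.w|` (so the kernel `t^{atoms} ψ` of a term of excess `e` involves the moments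
`atoms, …, atoms + e ⊆ [1, |w|]` of `ψ`). [folklore] -/
theorem terms_inv : ∀ (w : List ι), ∀ τ ∈ terms w,
    τ.c.Wf ∧ τ.w.length + τ.c.excess = w.length ∧ 1 ≤ τ.c.atoms ∧ τ.c.atoms ≤ τ.w.length
  | [], τ, h => by simp [terms] at h
  | i :: w, τ, h => by
    simp only [terms, List.mem_cons, List.mem_flatMap] at h
    rcases h with rfl | ⟨σ, hσ, hτ⟩
    · refine ⟨⟨List.cons_ne_nil _ _, trivial⟩, ?_, ?_, ?_⟩ <;>
        simp [CExpr.excess, CExpr.atoms]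
    · obtain ⟨hwf, hlen, hat1, hat2⟩ := terms_inv w σ hσ
      simp only [D, List.mem_append, List.mem_map, List.mem_cons, List.not_mem_nil,
        or_false] at hτ
      rcases hτ with ⟨c', hc', rfl⟩ | rfl | rfl
      · refine ⟨CExpr.wf_of_mem_D i _ hwf c' hc', ?_, ?_, ?_⟩
        · show σ.w.length + c'.excess = w.length + 1
          rw [CExpr.excess_of_mem_D i _ hwf c' hc']; omega
        · show 1 ≤ c'.atoms
          rw [CExpr.atoms_of_mem_D i _ c' hc']; exact hat1
        · show c'.atoms ≤ σ.w.length
          rw [CExpr.atoms_of_mem_D i _ c' hc']; exact hat2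
      · refine ⟨hwf, ?_, hat1, ?_⟩
        · show (some i :: σ.w).length + σ.c.excess = w.length + 1
          simp only [List.length_cons]; omega
        · show σ.c.atoms ≤ (some i :: σ.w).length
          simp only [List.length_cons]; omega
      · refine ⟨⟨List.cons_ne_nil _ _, hwf⟩, ?_, ?_, ?_⟩
        · show (none :: σ.w).length + (([i] : List ι).length - 1 + σ.c.excess) = w.length + 1
          simp only [List.length_cons, List.length_nil]; omega
        · show 1 ≤ 1 + σ.c.atoms
          omega
        · show 1 + σ.c.atoms ≤ (none :: σ.w).length
          simp only [List.length_cons]; omega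

variable {E' : Type*} [NormedAddCommGroup E'] [NormedSpace ℝ E']
variable {F : Type*} [NormedAddCommGroup F] [NormedSpace ℝ F]

/-- The direction denoted by a letter: `none ↦ u`, `some i ↦ bᵢ`. [folklore] -/
def dir (b : ι → E') (u : E') : Option ι → E'
  | none => u
  | some i => b i

omit [NormedAddCommGroup E'] [NormedSpace ℝ E'] in
/-- Translating basis letters gives the basis directions. [folklore] -/
@[simp]
theorem dir_comp_some (b : ι → E') (u : E') : dir b u ∘ some = b := rfl

/-- The kernels `t ↦ t^r ψ(t)`. [folklore] -/
def kernel (ψ : ℝ → ℝ) (r : ℕ) : ℝ → ℝ := fun t => t ^ r * ψ t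

/-- Evaluation of a symbolic term: `c(z) • lineOp u (∂_w g) (t^{atoms c} ψ) δ z`. [folklore] -/
def eval (b : ι → E') (u : E') (δ : E' → ℝ) (ψ : ℝ → ℝ) (g : E' → F) (τ : STerm ι) (z : E') : F :=
  τ.c.eval b δ z • lineOp u (iterDirDeriv (τ.w.map (dir b u)) g) (kernel ψ τ.c.atoms) δ z

end STerm

/-! ### The derivative formula -/

section Deriv

variable {ι : Type*} {E' : Type*} [NormedAddCommGroup E'] [NormedSpace ℝ E'] [FiniteDimensional ℝ E']
variable {F : Type*} [NormedAddCommGroup F] [NormedSpace ℝ F]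

/-- The candidate for `∂_w` of Stein's operator below the graph: the principal term plus the
generated terms, `steinR … w z = lineOp u (∂_w g) ψ δ z + Σ_{τ ∈ terms w} eval τ z`
(Stein, (26)). [cite: SteinSingularIntegrals1970, Ch. VI §3.2.3 (26)] -/
def steinR (b : ι → E') (u : E') (δ : E' → ℝ) (ψ : ℝ → ℝ) (g : E' → F) (w : List ι) (z : E') : F :=
  lineOp u (iterDirDeriv (w.map b) g) ψ δ z +
    ((STerm.terms w).map fun τ => STerm.eval b u δ ψ g τ z).sum

omit [FiniteDimensional ℝ E'] in
/-- At the empty word, `steinR` is Stein's formula itself: `∫ ψ(t) • g(z + t δ(z) u) dt`.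
[folklore] -/
theorem steinR_nil (b : ι → E') (u : E') (δ : E' → ℝ) (ψ : ℝ → ℝ) (g : E' → F) (z : E') :
    steinR b u δ ψ g [] z = lineOp u g ψ δ z := by
  simp [steinR, STerm.terms]

omit [FiniteDimensional ℝ E'] in
/-- The kernels are continuous with compact support if `ψ` is. [folklore] -/
theorem continuous_kernel {ψ : ℝ → ℝ} (hψ : Continuous ψ) (r : ℕ) : Continuous (STerm.kernel ψ r) :=
  (continuous_pow r).mul hψ

omit [FiniteDimensional ℝ E'] in
/-- The kernels have compact support if `ψ` has. [folklore] -/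
theorem hasCompactSupport_kernel {ψ : ℝ → ℝ} (hψ : HasCompactSupport ψ) (r : ℕ) :
    HasCompactSupport (STerm.kernel ψ r) := hψ.mul_left

omit [FiniteDimensional ℝ E'] in
/-- `t^{r+1} ψ = t (t^r ψ)`. [folklore] -/
theorem kernel_succ (ψ : ℝ → ℝ) (r : ℕ) :
    STerm.kernel ψ (r + 1) = fun t => t * STerm.kernel ψ r t := by
  funext t; simp only [STerm.kernel, pow_succ]; ring

omit [FiniteDimensional ℝ E'] in
/-- Derivatives of list sums of functions. [folklore] -/
theorem hasFDerivAt_list_sum {α : Type*} {f : α → E' → F} {f' : α → E' →L[ℝ] F} {z : E'} :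
    ∀ (L : List α), (∀ a ∈ L, HasFDerivAt (f a) (f' a) z) →
      HasFDerivAt (fun z => (L.map fun a => f a z).sum) (L.map f').sum z
  | [], _ => by simpa using hasFDerivAt_const (0 : F) z
  | a :: L, h => by
    have h1 := (h a (by simp)).add (hasFDerivAt_list_sum L fun a' ha' => h a' (by simp [ha']))
    simp only [List.map_cons, List.sum_cons]
    exact h1

omit [FiniteDimensional ℝ E'] in
/-- Evaluating a list sum of continuous linear maps. [folklore] -/
theorem list_sum_clm_apply {α : Type*} (f' : α → E' →L[ℝ] F) (v : E') :
    ∀ (L : List α), (L.map f').sum v = (L.map fun a => f' a v).sum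
  | [] => by simp
  | a :: L => by simp [list_sum_clm_apply f' v L]

omit [FiniteDimensional ℝ E'] in
/-- `(Σ_{a ∈ L} f a) • X = Σ_{a ∈ L} (f a • X)`. [folklore] -/
theorem list_sum_smul {α : Type*} (f : α → ℝ) (X : F) :
    ∀ (L : List α), (L.map f).sum • X = (L.map fun a => f a • X).sum
  | [] => by simp
  | a :: L => by simp [add_smul, list_sum_smul f X L]

omit [FiniteDimensional ℝ E'] [NormedSpace ℝ F] in
/-- Sums over `flatMap`. [folklore] -/
theorem list_sum_map_flatMap {α β : Type*} (f : α → List β) (g : β → F) :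
    ∀ (L : List α), ((L.flatMap f).map g).sum = (L.map fun a => ((f a).map g).sum).sum
  | [] => by simp
  | a :: L => by simp [List.flatMap_cons, list_sum_map_flatMap f g L]

variable (b : ι → E') (u : E') {δ : E' → ℝ} {ψ : ℝ → ℝ} {g : E' → F} {U : Set E'}

/-- **Derivative of one symbolic term** (the three kinds of children, Stein (26)): on `U`,
`∂_{bᵢ} (eval τ) = Σ_{τ' ∈ D i τ} eval τ'`. [folklore] -/
theorem STerm.hasFDerivAt_eval (hU : IsOpen U) (hδ : ContDiffOn ℝ ∞ δ U) (hψ : ContDiff ℝ ∞ ψ)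
    (hψc : HasCompactSupport ψ) (hg : ContDiff ℝ ∞ g) (τ : STerm ι) {z : E'} (hz : z ∈ U) :
    ∃ L : E' →L[ℝ] F, HasFDerivAt (STerm.eval b u δ ψ g τ) L z ∧
      ∀ i, L (b i) = ((τ.D i).map fun τ' => STerm.eval b u δ ψ g τ' z).sum := by
  set G : E' → F := iterDirDeriv (τ.w.map (STerm.dir b u)) g with hG
  have hGs : ContDiff ℝ ∞ G := contDiff_iterDirDeriv hg _
  have hδd : DifferentiableAt ℝ δ z := (hδ.differentiableOn (by simp)).differentiableAt (hU.mem_nhds hz)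
  have hcd : DifferentiableAt ℝ (τ.c.eval b δ) z :=
    ((CExpr.contDiffOn_eval b hU hδ τ.c).differentiableOn (by simp)).differentiableAt (hU.mem_nhds hz)
  obtain ⟨L, hL, hLv⟩ := hasFDerivAt_lineOp u (hGs.of_le (by norm_cast))
    (continuous_kernel hψ.continuous _) (hasCompactSupport_kernel hψc _) hδd
  refine ⟨_, hcd.hasFDerivAt.smul hL, fun i => ?_⟩
  rw [add_apply, smul_apply, hLv, ContinuousLinearMap.smulRight_apply,
    CExpr.fderiv_eval_apply b hU hδ i hz]
  simp only [STerm.D, List.map_append, List.map_cons, List.map_nil, List.sum_append,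
    List.sum_cons, List.sum_nil, add_zero, List.map_map]
  rw [add_comm]
  congr 1
  · -- derivative on the coefficient
    rw [list_sum_smul]
    refine congr_arg List.sum (List.map_congr_left fun c' hc' => ?_)
    simp only [comp_apply, STerm.eval, CExpr.atoms_of_mem_D i τ.c c' hc']
  · -- derivative on the function, and on the scale inside the function
    rw [smul_add]
    congr 1
    · show _ = (iterDirDeriv [b i] δ z * τ.c.eval b δ z) •
        lineOp u (fun x => fderiv ℝ G x u) (STerm.kernel ψ (1 + τ.c.atoms)) δ z
      rw [add_comm 1 τ.c.atoms, kernel_succ, smul_smul, mul_comm]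
      rfl

/-- **The derivative formula** `∂_{bᵢ} (steinR w) = steinR (i :: w)` on `U` (Stein, Ch. VI,
§3.2.3, (26), all orders): differentiating the principal term gives the new principal term and
the term `(∂ᵢ δ) ∫ t ψ • (∂ᵤ ∂_w g)`, and each generated term contributes its formal
derivative. [cite: SteinSingularIntegrals1970, Ch. VI §3.2.3 (26)] -/
theorem fderiv_steinR_apply (hU : IsOpen U) (hδ : ContDiffOn ℝ ∞ δ U) (hψ : ContDiff ℝ ∞ ψ)
    (hψc : HasCompactSupport ψ) (hg : ContDiff ℝ ∞ g) (w : List ι) {z : E'} (hz : z ∈ U) :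
    DifferentiableAt ℝ (steinR b u δ ψ g w) z ∧
      ∀ i, fderiv ℝ (steinR b u δ ψ g w) z (b i) = steinR b u δ ψ g (i :: w) z := by
  classical
  have hδd : DifferentiableAt ℝ δ z := (hδ.differentiableOn (by simp)).differentiableAt (hU.mem_nhds hz)
  -- principal term
  have hGs : ContDiff ℝ ∞ (iterDirDeriv (w.map b) g) := contDiff_iterDirDeriv hg _
  obtain ⟨L₀, hL₀, hL₀v⟩ := hasFDerivAt_lineOp u (hGs.of_le (by norm_cast))
    hψ.continuous hψc hδd
  -- generated terms
  choose L hL hLv using fun τ : STerm ι => STerm.hasFDerivAt_eval b u hU hδ hψ hψc hg τ hz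
  have hsum := hasFDerivAt_list_sum (f := fun τ z => STerm.eval b u δ ψ g τ z) (STerm.terms w)
    fun τ _ => hL τ
  have hall : HasFDerivAt (steinR b u δ ψ g w) (L₀ + ((STerm.terms w).map L).sum) z := hL₀.add hsum
  refine ⟨hall.differentiableAt, fun i => ?_⟩
  rw [hall.fderiv, add_apply, hL₀v, list_sum_clm_apply]
  simp only [hLv]
  rw [← list_sum_map_flatMap]
  show _ = lineOp u (iterDirDeriv ((i :: w).map b) g) ψ δ z +
    (STerm.eval b u δ ψ g ⟨CExpr.mul (CExpr.atom [i]) CExpr.one, none :: w.map some⟩ z +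
      (((STerm.terms w).flatMap (STerm.D i)).map fun τ => STerm.eval b u δ ψ g τ z).sum)
  rw [← add_assoc]
  congr 1
  congr 1
  -- the new term `(∂ᵢ δ) ∫ t ψ • (∂ᵤ ∂_w g)`
  have hk : STerm.kernel ψ 1 = fun t => t * ψ t := by funext t; simp [STerm.kernel]
  show _ = (iterDirDeriv [b i] δ z * 1) •
    lineOp u (iterDirDeriv ((none :: w.map some).map (STerm.dir b u)) g) (STerm.kernel ψ (1 + 0)) δ z
  rw [mul_one, add_zero, hk, List.map_cons, List.map_map, STerm.dir_comp_some]
  rfl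

end Deriv

/-! ### Pointwise bounds and boundary limits of the terms -/

section Bounds

variable {ι : Type*} {E' : Type*} [NormedAddCommGroup E'] [NormedSpace ℝ E']
variable {F : Type*} [NormedAddCommGroup F] [NormedSpace ℝ F]

/-- Composition of iterated directional derivatives: `∂_{α ++ β} = ∂_α ∂_β`. [folklore] -/
theorem iterDirDeriv_append (f : E' → F) (β : List E') : ∀ (α : List E'),
    iterDirDeriv (α ++ β) f = iterDirDeriv α (iterDirDeriv β f)
  | [] => rfl
  | v :: α => by simp only [List.cons_append, iterDirDeriv_cons, iterDirDeriv_append f β α]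

/-- `t⁰ ψ = ψ`. [folklore] -/
theorem kernel_zero (ψ : ℝ → ℝ) : STerm.kernel ψ 0 = ψ := by
  funext t; simp [STerm.kernel]

/-- The kernels vanish outside `[1, 2]` when `ψ` does. [folklore] -/
theorem kernel_eq_zero {ψ : ℝ → ℝ} (hψs : tsupport ψ ⊆ Icc 1 2) (r : ℕ) {t : ℝ}
    (ht : t ∉ Icc (1 : ℝ) 2) : STerm.kernel ψ r t = 0 := by
  simp only [STerm.kernel, image_eq_zero_of_notMem_tsupport (fun h => ht (hψs h)), mul_zero]

/-- With a kernel supported in `[1, 2]`, the line operator is an interval integral over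
`[1, 2]`. [folklore] -/
theorem lineOp_kernel_eq_intervalIntegral (u : E') (G : E' → F) {ψ : ℝ → ℝ}
    (hψs : tsupport ψ ⊆ Icc 1 2) (r : ℕ) (δ : E' → ℝ) (z : E') :
    lineOp u G (STerm.kernel ψ r) δ z =
      ∫ t in (1 : ℝ)..2, STerm.kernel ψ r t • G (z + (t * δ z) • u) := by
  rw [lineOp, intervalIntegral.integral_of_le one_le_two, ← integral_Icc_eq_integral_Ioc,
    setIntegral_eq_integral_of_forall_compl_eq_zero]
  intro t ht
  rw [kernel_eq_zero hψs r ht, zero_smul]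

/-- Moments of the kernels on `[1, 2]` are moments of `ψ`: `∫₁² tⁱ (tʳ ψ) = ∫ t^{i+r} ψ`.
[folklore] -/
theorem intervalIntegral_pow_mul_kernel {ψ : ℝ → ℝ} (hψs : tsupport ψ ⊆ Icc 1 2) (r i : ℕ) :
    ∫ t in (1 : ℝ)..2, t ^ i * STerm.kernel ψ r t = ∫ t, t ^ (i + r) * ψ t := by
  rw [intervalIntegral.integral_of_le one_le_two, ← integral_Icc_eq_integral_Ioc,
    setIntegral_eq_integral_of_forall_compl_eq_zero]
  · refine integral_congr_ae (Eventually.of_forall fun t => ?_)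
    simp only [STerm.kernel, pow_add]; ring
  · intro t ht
    rw [kernel_eq_zero hψs r ht, mul_zero]

omit [NormedSpace ℝ F] in
/-- **Change of scale in the vertical averages**: if `0 < d`, `2 d ≤ δ ≤ 16 d`, then
`∫₁² ‖V(t δ)‖ dt ≤ ½ ∫₂³² ‖V(σ d)‖ dσ` for continuous `V` (substitute `s = t δ`, enlarge
`[δ, 2δ] ⊆ [2d, 32d]`, substitute `s = σ d`; Stein, Ch. VI, §3.2.3, the passage from `δ*` to
the depth via Lemma 2). [folklore] -/
theorem intervalIntegral_norm_comp_scale_le {V : ℝ → F} (hV : Continuous V) {dd δδ : ℝ}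
    (hd : 0 < dd) (h1 : 2 * dd ≤ δδ) (h2 : δδ ≤ 16 * dd) :
    ∫ t in (1 : ℝ)..2, ‖V (t * δδ)‖ ≤ (1 / 2) * ∫ σ in (2 : ℝ)..32, ‖V (σ * dd)‖ := by
  have hδ0 : 0 < δδ := by linarith
  have hVn : Continuous fun s => ‖V s‖ := hV.norm
  have e1 : ∫ t in (1 : ℝ)..2, ‖V (t * δδ)‖ = δδ⁻¹ * ∫ s in δδ..(2 * δδ), ‖V s‖ := by
    rw [intervalIntegral.integral_comp_mul_right (fun s => ‖V s‖) hδ0.ne', smul_eq_mul, one_mul]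
  have e2 : ∫ σ in (2 : ℝ)..32, ‖V (σ * dd)‖ = dd⁻¹ * ∫ s in (2 * dd)..(32 * dd), ‖V s‖ := by
    rw [intervalIntegral.integral_comp_mul_right (fun s => ‖V s‖) hd.ne', smul_eq_mul]
  have hmono : ∫ s in δδ..(2 * δδ), ‖V s‖ ≤ ∫ s in (2 * dd)..(32 * dd), ‖V s‖ :=
    intervalIntegral.integral_mono_interval h1 (by linarith) (by linarith)
      (Eventually.of_forall fun s => norm_nonneg _) (hVn.intervalIntegrable _ _)
  have hI0 : 0 ≤ ∫ s in (2 * dd)..(32 * dd), ‖V s‖ :=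
    intervalIntegral.integral_nonneg (by linarith) fun s _ => norm_nonneg _
  rw [e1, e2]
  calc δδ⁻¹ * ∫ s in δδ..(2 * δδ), ‖V s‖ ≤ δδ⁻¹ * ∫ s in (2 * dd)..(32 * dd), ‖V s‖ :=
        mul_le_mul_of_nonneg_left hmono (inv_nonneg.2 hδ0.le)
    _ = (dd / δδ) * (dd⁻¹ * ∫ s in (2 * dd)..(32 * dd), ‖V s‖) := by
        field_simp
    _ ≤ (1 / 2) * (dd⁻¹ * ∫ s in (2 * dd)..(32 * dd), ‖V s‖) := by
        refine mul_le_mul_of_nonneg_right ?_ (mul_nonneg (inv_nonneg.2 hd.le) hI0)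
        rw [div_le_iff₀ hδ0]; linarith

variable [CompleteSpace F]
variable (b : ι → E') {u : E'} {δ d : E' → ℝ} {ψ : ℝ → ℝ} {g : E' → F} {k : ℕ}
  {B : List ι → ℝ} {Sψ : ℝ}

/-- The data of a term of the derivative formula: for `τ ∈ terms w` with `|w| ≤ k`, the
primitives `κ₁, …, κₑ` (`e` the excess) of the kernel `κ = t^{atoms} ψ` vanish at `2`, and
`∫₁² κₑ = 0`, because the corresponding moments of `ψ` have orders in `[1, k]` (Stein, Ch. VI,
§3.2.3: "in view of (26) ... `∫ λ^j ψ(λ) dλ = 0`"). [folklore] -/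
theorem primChain_kernel_vanish (hψ : Continuous ψ) (hψs : tsupport ψ ⊆ Icc 1 2)
    (hmom : ∀ j : ℕ, 1 ≤ j → j ≤ k → ∫ t, t ^ j * ψ t = 0) {w : List ι} (hw : w.length ≤ k)
    {τ : STerm ι} (hτ : τ ∈ STerm.terms w) :
    (∀ j, 1 ≤ j → j ≤ τ.c.excess → primChain (STerm.kernel ψ τ.c.atoms) j 2 = 0) ∧
      ∫ t in (1 : ℝ)..2, primChain (STerm.kernel ψ τ.c.atoms) τ.c.excess t = 0 := by
  obtain ⟨-, hlen, hat1, hat2⟩ := STerm.terms_inv w τ hτ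
  have hκ : Continuous (STerm.kernel ψ τ.c.atoms) := (continuous_pow _).mul hψ
  have h0 : ∀ i, i ≤ τ.c.excess → ∫ t in (1 : ℝ)..2, t ^ i * STerm.kernel ψ τ.c.atoms t = 0 := by
    intro i hi
    rw [intervalIntegral_pow_mul_kernel hψs]
    exact hmom _ (by omega) (by omega)
  refine ⟨fun j hj1 hje => ?_, intervalIntegral_primChain_eq_zero hκ h0⟩
  obtain ⟨j', rfl⟩ : ∃ j', j = j' + 1 := ⟨j - 1, by omega⟩
  exact primChain_apply_two_eq_zero hκ h0 (by omega)

/-- Sup bound for the primitives of the kernels: `|κ_j| ≤ 2^{atoms} sup |ψ|` on `[1, 2]`.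
[folklore] -/
theorem abs_primChain_kernel_le (hS : ∀ t, |ψ t| ≤ Sψ) (r j : ℕ) {t : ℝ} (ht : t ∈ Icc (1 : ℝ) 2) :
    |primChain (STerm.kernel ψ r) j t| ≤ 2 ^ r * Sψ := by
  refine abs_primChain_le (fun s hs => ?_) j t ht
  rw [STerm.kernel, abs_mul, abs_pow, abs_of_nonneg (by linarith [hs.1])]
  exact mul_le_mul (pow_le_pow_left₀ (by linarith [hs.1]) hs.2 r) (hS s) (abs_nonneg _)
    (pow_nonneg zero_le_two _)

/-- **Pointwise bound for a term** (Stein, Ch. VI, §3.2.3, (27)–(28): each term of a derivative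
of order `m` of `𝔈(f)` below the graph is bounded by an average of `|∇^m f|` over the vertical
segment above, with a constant independent of the domain beyond its bound). For
`τ ∈ terms w`, `|w| ≤ k`, `z ∈ U = {d > 0}` with `2d ≤ δ ≤ 16 d` and atom bounds
`|∂_β δ| d^{|β|-1} ≤ B β` on `U`:
`‖eval τ z‖ ≤ bound B τ.c · 16ᵉ · 2^{atoms} sup|ψ| · ½ ∫₂³² ‖(∂ᵤᵉ ∂_{τ.w} g)(z + σ d(z) u)‖ dσ`,
`e` the excess (integrate by parts `e` times along the line, then change scale).
[cite: SteinSingularIntegrals1970, Ch. VI §3.2.3 (26)–(28)] -/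
theorem norm_eval_le (hψ : ContDiff ℝ ∞ ψ) (hψs : tsupport ψ ⊆ Icc 1 2) (hS : ∀ t, |ψ t| ≤ Sψ)
    (hmom : ∀ j : ℕ, 1 ≤ j → j ≤ k → ∫ t, t ^ j * ψ t = 0) (hg : ContDiff ℝ ∞ g)
    (hB : ∀ β : List ι, β ≠ [] → ∀ z, 0 < d z →
      |iterDirDeriv (β.map b) δ z| * d z ^ (β.length - 1) ≤ B β)
    (hB0 : ∀ β, 0 ≤ B β) (hδ : ∀ z, 0 < d z → 2 * d z ≤ δ z ∧ δ z ≤ 16 * d z)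
    {w : List ι} (hw : w.length ≤ k) {τ : STerm ι} (hτ : τ ∈ STerm.terms w) {z : E'}
    (hz : 0 < d z) :
    ‖STerm.eval b u δ ψ g τ z‖ ≤ τ.c.bound B * 16 ^ τ.c.excess * (2 ^ τ.c.atoms * Sψ) *
      ((1 / 2) * ∫ σ in (2 : ℝ)..32,
        ‖iterDirDeriv (List.replicate τ.c.excess u ++ τ.w.map (STerm.dir b u)) g
          (z + (σ * d z) • u)‖) := by
  obtain ⟨hwf, hlen, hat1, hat2⟩ := STerm.terms_inv w τ hτ
  obtain ⟨hvan, -⟩ := primChain_kernel_vanish hψ.continuous hψs hmom hw hτ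
  set e := τ.c.excess with he
  set r := τ.c.atoms with hr
  set G : E' → F := iterDirDeriv (τ.w.map (STerm.dir b u)) g with hG
  have hGs : ContDiff ℝ ∞ G := contDiff_iterDirDeriv hg _
  set Ge : E' → F := iterDirDeriv (List.replicate e u) G with hGe
  have hGes : ContDiff ℝ ∞ Ge := contDiff_iterDirDeriv hGs _
  have hGe' : iterDirDeriv (List.replicate e u ++ τ.w.map (STerm.dir b u)) g = Ge := by
    rw [hGe, hG, iterDirDeriv_append]
  rw [hGe']
  have hκ : Continuous (STerm.kernel ψ r) := (continuous_pow _).mul hψ.continuous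
  obtain ⟨h2d, h16d⟩ := hδ z hz
  have hδ0 : 0 < δ z := by linarith
  -- integrate by parts `e` times along the line
  have hibp : ∫ t in (1 : ℝ)..2, STerm.kernel ψ r t • G (z + (t * δ z) • u) =
      (-δ z) ^ e • ∫ t in (1 : ℝ)..2, primChain (STerm.kernel ψ r) e t • Ge (z + (t * δ z) • u) :=
    intervalIntegral_smul_comp_line_eq u hκ (δ z) z e hGs hvan
  rw [STerm.eval, lineOp_kernel_eq_intervalIntegral u G hψs r δ z, hibp]
  simp only [norm_smul, norm_pow, norm_neg, Real.norm_eq_abs]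
  rw [abs_of_pos hδ0]
  -- the remaining integral
  have hV : Continuous fun t : ℝ => Ge (z + (t * δ z) • u) :=
    hGes.continuous.comp (continuous_const.add ((continuous_id.mul continuous_const).smul
      continuous_const))
  have hint : ‖∫ t in (1 : ℝ)..2, primChain (STerm.kernel ψ r) e t • Ge (z + (t * δ z) • u)‖ ≤
      (2 ^ r * Sψ) * ∫ t in (1 : ℝ)..2, ‖Ge (z + (t * δ z) • u)‖ := by
    refine (intervalIntegral.norm_integral_le_integral_norm one_le_two).trans ?_
    rw [← intervalIntegral.integral_const_mul]
    refine intervalIntegral.integral_mono_on one_le_two ?_ ?_ fun t ht => ?_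
    · exact (((continuous_primChain hκ e).smul hV).norm).intervalIntegrable _ _
    · exact (continuous_const.mul hV.norm).intervalIntegrable _ _
    · rw [norm_smul, Real.norm_eq_abs]
      exact mul_le_mul_of_nonneg_right (abs_primChain_kernel_le hS r e ht) (norm_nonneg _)
  have hscale : ∫ t in (1 : ℝ)..2, ‖Ge (z + (t * δ z) • u)‖ ≤
      (1 / 2) * ∫ σ in (2 : ℝ)..32, ‖Ge (z + (σ * d z) • u)‖ :=
    intervalIntegral_norm_comp_scale_le (V := fun s => Ge (z + s • u))
      (hGes.continuous.comp (continuous_const.add (continuous_id.smul continuous_const))) hz h2d h16d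
  -- the coefficient
  have hcoef : |τ.c.eval b δ z| * δ z ^ e ≤ τ.c.bound B * 16 ^ e := by
    have h1 := CExpr.abs_eval_mul_pow_le b (U := {z | 0 < d z}) (fun β hβ z hz => hB β hβ z hz)
      hB0 (fun z hz => hz) hz τ.c hwf
    calc |τ.c.eval b δ z| * δ z ^ e ≤ |τ.c.eval b δ z| * (16 * d z) ^ e := by gcongr
      _ = (|τ.c.eval b δ z| * d z ^ e) * 16 ^ e := by rw [mul_pow]; ring
      _ ≤ τ.c.bound B * 16 ^ e := mul_le_mul_of_nonneg_right h1 (pow_nonneg (by norm_num) _)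
  have hI0 : 0 ≤ ∫ σ in (2 : ℝ)..32, ‖Ge (z + (σ * d z) • u)‖ :=
    intervalIntegral.integral_nonneg (by norm_num) fun s _ => norm_nonneg _
  calc |τ.c.eval b δ z| * (δ z ^ e *
        ‖∫ t in (1 : ℝ)..2, primChain (STerm.kernel ψ r) e t • Ge (z + (t * δ z) • u)‖)
      = (|τ.c.eval b δ z| * δ z ^ e) *
        ‖∫ t in (1 : ℝ)..2, primChain (STerm.kernel ψ r) e t • Ge (z + (t * δ z) • u)‖ := by ring
    _ ≤ (τ.c.bound B * 16 ^ e) * ((2 ^ r * Sψ) * ((1 / 2) * ∫ σ in (2 : ℝ)..32,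
        ‖Ge (z + (σ * d z) • u)‖)) := by
        refine mul_le_mul hcoef (hint.trans (mul_le_mul_of_nonneg_left hscale ?_)) (norm_nonneg _)
          (mul_nonneg (CExpr.bound_nonneg hB0 _) (pow_nonneg (by norm_num) _))
        exact mul_nonneg (pow_nonneg zero_le_two _) ((abs_nonneg _).trans (hS 0))
    _ = τ.c.bound B * 16 ^ e * (2 ^ r * Sψ) *
        ((1 / 2) * ∫ σ in (2 : ℝ)..32, ‖Ge (z + (σ * d z) • u)‖) := by ring

/-- **The terms tend to zero at the boundary** (Stein, Ch. VI, §3.2.3, the step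
"`= O(δ) → 0` as `(x, y)` tends to the boundary"): for `τ ∈ terms w`, `|w| ≤ k`, as `z → z₀`
within `U = {d > 0}` with `d(z₀) = 0` (`d` continuous, `2d ≤ δ ≤ 16 d` on `U`): after the `e`
integrations by parts the integral against `κₑ`, which has `∫ κₑ = 0`, tends to
`(∫ κₑ) (∂ᵤᵉ ∂_w g)(z₀) = 0`, while the coefficient `c(z) δ(z)ᵉ` stays bounded.
[cite: SteinSingularIntegrals1970, Ch. VI §3.2.3 (O(δ) → 0 at the boundary)] -/
theorem tendsto_eval_zero (hψ : ContDiff ℝ ∞ ψ) (hψs : tsupport ψ ⊆ Icc 1 2)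
    (hmom : ∀ j : ℕ, 1 ≤ j → j ≤ k → ∫ t, t ^ j * ψ t = 0) (hg : ContDiff ℝ ∞ g)
    (hdc : Continuous d)
    (hB : ∀ β : List ι, β ≠ [] → ∀ z, 0 < d z →
      |iterDirDeriv (β.map b) δ z| * d z ^ (β.length - 1) ≤ B β)
    (hB0 : ∀ β, 0 ≤ B β) (hδ : ∀ z, 0 < d z → 2 * d z ≤ δ z ∧ δ z ≤ 16 * d z)
    {w : List ι} (hw : w.length ≤ k) {τ : STerm ι} (hτ : τ ∈ STerm.terms w) {z₀ : E'}
    (hz₀ : d z₀ = 0) :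
    Tendsto (STerm.eval b u δ ψ g τ) (𝓝[{z | 0 < d z}] z₀) (𝓝 0) := by
  obtain ⟨hwf, hlen, hat1, hat2⟩ := STerm.terms_inv w τ hτ
  obtain ⟨hvan, hint0⟩ := primChain_kernel_vanish hψ.continuous hψs hmom hw hτ
  set e := τ.c.excess with he
  set r := τ.c.atoms with hr
  set G : E' → F := iterDirDeriv (τ.w.map (STerm.dir b u)) g with hG
  have hGs : ContDiff ℝ ∞ G := contDiff_iterDirDeriv hg _
  set Ge : E' → F := iterDirDeriv (List.replicate e u) G with hGe
  have hGes : ContDiff ℝ ∞ Ge := contDiff_iterDirDeriv hGs _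
  have hκ : Continuous (STerm.kernel ψ r) := (continuous_pow _).mul hψ.continuous
  -- `δ → 0` and `z → z₀` along the filter
  have hz : Tendsto (fun z : E' => z) (𝓝[{z | 0 < d z}] z₀) (𝓝 z₀) :=
    tendsto_id.mono_left nhdsWithin_le_nhds
  have hd0 : Tendsto d (𝓝[{z | 0 < d z}] z₀) (𝓝 0) :=
    hz₀ ▸ (hdc.tendsto z₀).mono_left nhdsWithin_le_nhds
  have hδ0 : Tendsto δ (𝓝[{z | 0 < d z}] z₀) (𝓝 0) := by
    refine tendsto_of_tendsto_of_tendsto_of_le_of_le' hd0 ?_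
      (eventually_nhdsWithin_of_forall fun z hz => by
        have hz' : 0 < d z := hz
        linarith [(hδ z hz').1])
      (eventually_nhdsWithin_of_forall fun z hz => (hδ z hz).2)
    simpa using hd0.const_mul 16
  -- the integral after integration by parts tends to `(∫ κₑ) • Ge z₀ = 0`
  have hI : Tendsto (fun z => ∫ t in (1 : ℝ)..2,
      primChain (STerm.kernel ψ r) e t • Ge (z + (t * δ z) • u)) (𝓝[{z | 0 < d z}] z₀) (𝓝 0) := by
    have := tendsto_intervalIntegral_smul_comp_line u (continuous_primChain hκ e) hGes.continuous
      (z₀ := z₀) hz hδ0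
    rwa [hint0, zero_smul] at this
  -- the rewritten term: bounded coefficient times the integral
  have heq : ∀ z, 0 < d z → STerm.eval b u δ ψ g τ z = (τ.c.eval b δ z * (-δ z) ^ e) •
      ∫ t in (1 : ℝ)..2, primChain (STerm.kernel ψ r) e t • Ge (z + (t * δ z) • u) := fun z hz => by
    rw [STerm.eval, lineOp_kernel_eq_intervalIntegral u G hψs r δ z,
      intervalIntegral_smul_comp_line_eq u hκ (δ z) z e hGs hvan, smul_smul]
  have hbdd : ∀ z, 0 < d z → |τ.c.eval b δ z * (-δ z) ^ e| ≤ τ.c.bound B * 16 ^ e := fun z hz => by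
    obtain ⟨h2d, h16d⟩ := hδ z hz
    have h1 := CExpr.abs_eval_mul_pow_le b (U := {z | 0 < d z}) (fun β hβ z hz => hB β hβ z hz)
      hB0 (fun z hz => hz) hz τ.c hwf
    have hδz : 0 < δ z := by linarith
    rw [abs_mul, abs_pow, abs_neg, abs_of_pos hδz]
    calc |τ.c.eval b δ z| * δ z ^ e ≤ |τ.c.eval b δ z| * (16 * d z) ^ e := by
          gcongr
      _ = (|τ.c.eval b δ z| * d z ^ e) * 16 ^ e := by rw [mul_pow]; ring
      _ ≤ τ.c.bound B * 16 ^ e := mul_le_mul_of_nonneg_right h1 (pow_nonneg (by norm_num) _)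
  rw [tendsto_zero_iff_norm_tendsto_zero]
  refine squeeze_zero_norm' (eventually_nhdsWithin_of_forall fun z hz => ?_)
    (by simpa using (tendsto_zero_iff_norm_tendsto_zero.1 hI).const_mul (τ.c.bound B * 16 ^ e))
  rw [norm_norm, heq z hz, norm_smul, Real.norm_eq_abs]
  exact mul_le_mul_of_nonneg_right (hbdd z hz) (norm_nonneg _)

/-- **The principal term reproduces the boundary values** (Stein, Ch. VI, §3.2.3, from
`∫ ψ = 1`): `∫ ψ(t) • G(z + t δ(z) u) dt → G(z₀)` as `z → z₀` within `U`. [folklore] -/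
theorem tendsto_lineOp_principal (hψ : Continuous ψ) (hψs : tsupport ψ ⊆ Icc 1 2)
    (hψ1 : ∫ t, ψ t = 1) {G : E' → F} (hG : Continuous G) (hdc : Continuous d)
    (hδ : ∀ z, 0 < d z → 2 * d z ≤ δ z ∧ δ z ≤ 16 * d z) {z₀ : E'} (hz₀ : d z₀ = 0) :
    Tendsto (lineOp u G ψ δ) (𝓝[{z | 0 < d z}] z₀) (𝓝 (G z₀)) := by
  have hz : Tendsto (fun z : E' => z) (𝓝[{z | 0 < d z}] z₀) (𝓝 z₀) :=
    tendsto_id.mono_left nhdsWithin_le_nhds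
  have hd0 : Tendsto d (𝓝[{z | 0 < d z}] z₀) (𝓝 0) :=
    hz₀ ▸ (hdc.tendsto z₀).mono_left nhdsWithin_le_nhds
  have hδ0 : Tendsto δ (𝓝[{z | 0 < d z}] z₀) (𝓝 0) := by
    refine tendsto_of_tendsto_of_tendsto_of_le_of_le' hd0 ?_
      (eventually_nhdsWithin_of_forall fun z hz => by
        have hz' : 0 < d z := hz
        linarith [(hδ z hz').1])
      (eventually_nhdsWithin_of_forall fun z hz => (hδ z hz).2)
    simpa using hd0.const_mul 16
  have h1 : ∫ t in (1 : ℝ)..2, ψ t = 1 := by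
    have := intervalIntegral_pow_mul_kernel hψs 0 0
    simp only [pow_zero, one_mul, STerm.kernel, zero_add] at this
    rw [this, hψ1]
  have hmain := tendsto_intervalIntegral_smul_comp_line u hψ hG (z₀ := z₀) hz hδ0
  rw [h1, one_smul] at hmain
  refine hmain.congr fun z => ?_
  have := lineOp_kernel_eq_intervalIntegral u G hψs 0 δ z
  rw [kernel_zero] at this
  exact this.symm

/-- **Boundary limits of the derivative formula**: `steinR w z → (∂_w g)(z₀)` as `z → z₀`
within `U` (`d z₀ = 0`, `|w| ≤ k`): the principal term reproduces `∂_w g`, all other terms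
tend to zero (Stein, Ch. VI, §3.2.3: the derivatives of `𝔈(f)` of order `≤ k` extend
continuously to the boundary with the values of those of `f`).
[cite: SteinSingularIntegrals1970, Ch. VI §3.2.3 (boundary values of the derivatives)] -/
theorem tendsto_steinR [FiniteDimensional ℝ E'] (hψ : ContDiff ℝ ∞ ψ) (hψs : tsupport ψ ⊆ Icc 1 2)
    (hψ1 : ∫ t, ψ t = 1) (hmom : ∀ j : ℕ, 1 ≤ j → j ≤ k → ∫ t, t ^ j * ψ t = 0)
    (hg : ContDiff ℝ ∞ g) (hdc : Continuous d)
    (hB : ∀ β : List ι, β ≠ [] → ∀ z, 0 < d z →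
      |iterDirDeriv (β.map b) δ z| * d z ^ (β.length - 1) ≤ B β)
    (hB0 : ∀ β, 0 ≤ B β) (hδ : ∀ z, 0 < d z → 2 * d z ≤ δ z ∧ δ z ≤ 16 * d z)
    {w : List ι} (hw : w.length ≤ k) {z₀ : E'} (hz₀ : d z₀ = 0) :
    Tendsto (steinR b u δ ψ g w) (𝓝[{z | 0 < d z}] z₀) (𝓝 (iterDirDeriv (w.map b) g z₀)) := by
  have h1 := tendsto_lineOp_principal (u := u) (δ := δ) hψ.continuous hψs hψ1
    (contDiff_iterDirDeriv hg (w.map b)).continuous hdc hδ hz₀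
  have h2 := tendsto_list_sum (STerm.terms w) (f := fun τ z => STerm.eval b u δ ψ g τ z)
    (a := fun _ => (0 : F)) (x := 𝓝[{z | 0 < d z}] z₀)
    fun τ hτ => tendsto_eval_zero b hψ hψs hmom hg hdc hB hB0 hδ hw hτ hz₀
  simp only [List.map_const', List.sum_replicate, smul_zero] at h2
  show Tendsto (fun z => lineOp u (iterDirDeriv (w.map b) g) ψ δ z +
    ((STerm.terms w).map fun τ => STerm.eval b u δ ψ g τ z).sum) _ _
  simpa using h1.add h2

end Bounds

/-! ### Stein's operator, pointwise -/

section Operator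

variable {E' : Type*} [NormedAddCommGroup E'] [NormedSpace ℝ E']
variable {F : Type*} [NormedAddCommGroup F] [NormedSpace ℝ F]

/-- **Stein's extension operator for a special Lipschitz domain, pointwise** (Stein, Ch. VI,
§3.2, (24)): for a depth function `d` (the domain being `{d < 0}`), `steinOp u d ψ δ f` is `f`
on and above the graph (`d ≤ 0`) and `∫ ψ(t) • f(z + t δ(z) u) dt` below it (`d > 0`).
[cite: SteinSingularIntegrals1970, Ch. VI §3.2 (24)] -/
def steinOp (u : E') (d : E' → ℝ) (ψ : ℝ → ℝ) (δ : E' → ℝ) (f : E' → F) (z : E') : F :=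
  if 0 < d z then lineOp u f ψ δ z else f z

/-- `steinOp` is the identity on and above the graph. [folklore] -/
theorem steinOp_of_nonpos (u : E') (d : E' → ℝ) (ψ : ℝ → ℝ) (δ : E' → ℝ) (f : E' → F) {z : E'}
    (hz : d z ≤ 0) : steinOp u d ψ δ f z = f z := if_neg (not_lt.2 hz)

/-- `steinOp` is Stein's formula below the graph. [folklore] -/
theorem steinOp_of_pos (u : E') (d : E' → ℝ) (ψ : ℝ → ℝ) (δ : E' → ℝ) (f : E' → F) {z : E'}
    (hz : 0 < d z) : steinOp u d ψ δ f z = lineOp u f ψ δ z := if_pos hz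

/-- `steinOp` commutes with scalars (for all functions). [folklore] -/
theorem steinOp_const_smul (u : E') (d : E' → ℝ) (ψ : ℝ → ℝ) (δ : E' → ℝ) (c : ℝ) (f : E' → F) :
    steinOp u d ψ δ (c • f) = c • steinOp u d ψ δ f := by
  funext z
  by_cases hz : 0 < d z
  · simp only [steinOp, if_pos hz, Pi.smul_apply]
    exact lineOp_const_smul u c f ψ δ z
  · simp only [steinOp, if_neg hz, Pi.smul_apply]

/-- `steinOp` is additive on continuous functions (for a continuous compactly supported kernel).
[folklore] -/
theorem steinOp_add (u : E') (d : E' → ℝ) {ψ : ℝ → ℝ} (hψ : Continuous ψ)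
    (hψc : HasCompactSupport ψ) (δ : E' → ℝ) {f g : E' → F} (hf : Continuous f)
    (hg : Continuous g) : steinOp u d ψ δ (f + g) = steinOp u d ψ δ f + steinOp u d ψ δ g := by
  funext z
  by_cases hz : 0 < d z
  · simp only [steinOp, if_pos hz, Pi.add_apply]
    exact lineOp_add u hf hg hψ hψc δ z
  · simp only [steinOp, if_neg hz, Pi.add_apply]

end Operator

/-! ### Sobolev sums of smooth functions along a family of directions -/

section SmoothSobolev

variable {E' : Type*} [NormedAddCommGroup E'] [NormedSpace ℝ E'] [MeasurableSpace E']
variable {F : Type*} [NormedAddCommGroup F] [NormedSpace ℝ F]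
variable {ι : Type*} [Fintype ι]

/-- The recursive Sobolev sum of a function along a family of directions `b`:
`swN 0 h = ‖h‖_{L^p(ν)}`, `swN (k+1) h = ‖h‖_{L^p(ν)} + Σᵢ swN k (∂_{bᵢ} h)` (the form of
`eSobolevDomainNorm` with classical in place of weak derivatives). [folklore] -/
def swN (b : ι → E') (p : ℝ≥0∞) (ν : Measure E') : ℕ → (E' → F) → ℝ≥0∞
  | 0, h => eLpNorm h p ν
  | k + 1, h => eLpNorm h p ν + ∑ i, swN b p ν k (fun x => fderiv ℝ h x (b i))

/-- Unfolding `swN 0`. [folklore] -/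
@[simp]
theorem swN_zero (b : ι → E') (p : ℝ≥0∞) (ν : Measure E') (h : E' → F) :
    swN b p ν 0 h = eLpNorm h p ν := rfl

/-- Unfolding `swN (k+1)`. [folklore] -/
theorem swN_succ (b : ι → E') (p : ℝ≥0∞) (ν : Measure E') (k : ℕ) (h : E' → F) :
    swN b p ν (k + 1) h = eLpNorm h p ν + ∑ i, swN b p ν k (fun x => fderiv ℝ h x (b i)) := rfl

/-- The pure words: `L^p` sum over all words of length `m` in the basis directions. [folklore] -/
def pureN (b : ι → E') (p : ℝ≥0∞) (ν : Measure E') (m : ℕ) (G : E' → F) : ℝ≥0∞ :=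
  ∑ β : Fin m → ι, eLpNorm (iterDirDeriv ((List.ofFn β).map b) G) p ν

end SmoothSobolev

end Literature.Analysis.FunctionSpaces
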